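import Summits.QuantumFields.BalabanUV.Beta.EriceRemainderEnclosureHistoryAutonomyComparisonAgeCompositionEnteringLag
import Summits.QuantumFields.BalabanUV.Beta.EriceRemainderEnclosureHistoryAutonomyComparisonAgeCompositionCriteriaFlow
import Summits.QuantumFields.BalabanUV.Beta.EriceRemainderEnclosureHistoryAutonomyComparisonAgeCompositionYoungestTailSumFlow

/-!
# EriceRemainderEnclosureHistoryAutonomyComparisonAgeCompositionEnteringLagFlow — (E83b) THE FLOW'S LONE KERNELS HAVE THE ONE-LAG STRUCTURE, EVERY AGE'S
# COEFFICIENT OBEYS THE ONE-LAG DECAY `c_{m+1}(1 + c_m) ≤ c_m` ALONG EVERY BOX SOLUTION, hence MONO″ of the oldest age is FREE in the edge regime for every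
# damping, follows from the entering-lag criterion at the pins `m + 1 + k ≤ K` in general, and holds OUTRIGHT — every age, pin, truncation — in the
# undamped first-order model

Cell `pub-balaban`, β-function sub-cell, BINDER row D4 «RemainderConst leaves for Bałaban's split» (`HOME/BINDER-OWNERS.md`; owner lineage `b2b-balaban-beta-an4`;
this file by co-owner #2 lineage `b2b-balaban-beta-d4-p2`, generation 74), β-FLOW TEAM duty (1), FREEZE (0) honoured (def-free; imports (E83a) `…EnteringLag`,
(E81d) `…CriteriaFlow`, (E82b) `…YoungestTailSumFlow`; uses (E58b) `mul_invSq_add_le`, (E75a) `persistence_eq`, `defect_nonneg`, `load_le_cap_at_pin`,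
`weight_nonneg`, (E82b) `row_mass_le`, `kernel_entry_le`, (E83a) `mono2_top_of_onelag` BY NAME; nothing restated).

HONEST FRAMING (page 1, verbatim and binding).  *"Discharging BetaPertH makes Bałaban's UV stability UNCONDITIONAL — a real constructive-QFT result; it is
NOT the continuum limit and NOT the Clay problem."*  THIS FILE DISCHARGES NOTHING OF THE KIND.  Elementary real analysis about ABSTRACT functionals on a box
]0,γ]^ℕ with displayed floors and profiles, and the FIRST-ORDER renewal objects of route (N) built from them — hypotheses of a census, not facts; the age
profile of Bałaban's (1.22) limit functional is NOT PRINTED ([I] p. 298; GAPS G-t4-U2-1∕-2) and NOT asserted.  Row D4 class UNCHANGED (critical-path width 0;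
instance 0∕1; D4 DISCHARGE NO DATE).  HONEST DEPENDENCY: continuum YM on T⁴ ⇐ BetaPertH ∧ nine spine estimates (0/9 proved); BetaPertH ⇐ (D1) ∧ (D4) ∧
CAP+tail; G-an2-4 gates asym, D1 and NE2/3/4.

THE POINT (census sense (α); route (N); README `HOME/b2b-balaban-beta-d4-p2/g74/e83/README.md`).  §1 the flow's lone kernel of an age `k`
(`KL k m l = (L_kh_{m+k}³∕2)·Π_{t=m+1+l}^{m+k} g_t`, (E80e)) has (E83a)'s ONE-LAG STRUCTURE with `σ_m = 1 − θ_k(m;1) = (h_{m+k+1}∕h_{m+k})³·g_{m+k+1} ∈ ]0,1]`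
((E75a) `persistence_eq` at lag one).  §2 **`cube_ratio_one_lag`**: for EVERY age `1 ≤ k < K` of the dominating profile, along every box solution,
`(h_{m+k+1}∕h_{m+k})³·(1 + L_kh_{m+k}³∕2) ≤ 1` — the ONE-LAG DECAY OF THE AGE'S OWN COEFFICIENT (the level step at depth `m+k` reads the age's own coupling
`h_{m+2k+1} ≥ h_{m+k}∕√3` by concavity; (E81b) proved the age `1`); hence `flow_onelag_decay`: `σ_m·(1 + KL k m 0) ≤ 1`.  §3 the oldest age's truncation
reads are supersolution data (`flow_row_mass_le_one`: `x̃_k ≤ x_k ≤ 1` by the window budget; `flow_trunc_key`).  §4 **`flow_mono2_top_of_crit`**: (E83a)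
`mono2_top_of_onelag` for the flow — for every damping in the relaxed class, MONO″ of the age `k` for every truncation `j ≤ K` GIVEN the entering-lag
criterion at the pins `m` with `m + 1 + k ≤ K` (with `K = k + 1`: the single pin `m = 0`); the edge regime costs nothing.  §5 **`flow_mono2_top_undamped`**:
with `g ≡ 1` the criterion's left side is `c_{m+1} − (c_{m+1}∕c_m)·c_m = 0` — MONO″ OF EVERY AGE `k` OF EVERY PROFILE ALONG EVERY BOX SOLUTION, EVERY PIN
AND TRUNCATION, IN THE UNDAMPED FIRST-ORDER MODEL, with no hypothesis left.  NUMERICS OF RECORD (`g74/numerics/o1.py`–`o5.py`): the damped criterion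
(relaxed class; worst damping = row `m`'s window at the floor, entering scale undamped) has ratio ≤ 0.81 at the pin and → 1⁻ deep in the ultraviolet
with margin `∝ (3λ−2)·x` along lone flows (`k ≤ 64`); under a SATURATED YOUNG age the window floor `Π(1+F_t)^{-1} ≈ (m∕(m+k))^{1∕3}` decays and the
relaxed-class margin at long windows is decided at second order (README §3) — NOT CLAIMED here.  NOT CLAIMED: the damped criterion; anything nonlinear;
anything printed.

WHAT IS PROVED ([folklore]; 0 `def`, 0 sorry).  §1 `flow_window_zero`, `flow_onelag_structure`, `flow_sigma_mem`.  §2 **`cube_ratio_one_lag`**,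
**`flow_onelag_decay`**.  §3 `flow_row_mass_le_one`, `flow_trunc_key`.  §4 **`flow_mono2_top_of_crit`**.  §5 `undamped_entry`, **`flow_mono2_top_undamped`**.
-/
noncomputable section
open Finset

namespace Summit.QuantumFields.BalabanUV.Beta.EriceRemainderEnclosureHistoryAutonomyComparisonAgeCompositionEnteringLagFlow

open Literature.MathematicalPhysics.QuantumFieldTheory.Balaban1983to89
open Literature.MathematicalPhysics.QuantumFieldTheory.Balaban1983to89.T4BetaStationary
open Literature.MathematicalPhysics.QuantumFieldTheory.Balaban1983to89.T4BetaFlowWellPosed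
open Summit.QuantumFields.BalabanUV.Beta.EriceRemainderEnclosureHistoryAutonomyOrder (strictAnti_of_memFlow)
open Summit.QuantumFields.BalabanUV.Beta.EriceRemainderEnclosureHistoryAutonomyComparisonAffineProfile (mul_invSq_add_le)
open Summit.QuantumFields.BalabanUV.Beta.EriceRemainderEnclosureHistoryAutonomyComparisonAgeComposition
open Summit.QuantumFields.BalabanUV.Beta.EriceRemainderEnclosureHistoryAutonomyComparisonAgeCompositionIdentification
open Summit.QuantumFields.BalabanUV.Beta.EriceRemainderEnclosureHistoryAutonomyComparisonAgeCompositionYoungestTailSumFlow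
open Summit.QuantumFields.BalabanUV.Beta.EriceRemainderEnclosureHistoryAutonomyComparisonAgeCompositionEnteringLag

variable {B : (ℕ → ℝ) → ℝ} {γ b gIR : ℝ} {L : ℕ → ℝ} {K : ℕ} {h g : ℕ → ℝ} {KL : ℕ → ℕ → ℕ → ℝ} {θ : ℕ → ℕ → ℕ → ℝ}

/-! ## §1 The flow's lone kernels have the one-lag structure -/

/-- The lone kernel of age `k` reads only the lags `< k`. [folklore] -/
theorem flow_window_zero
    (hKL : ∀ k n l, KL k n l = if 0 < k ∧ k < K ∧ l < k then L k * h (n + k) ^ 3 / 2 * ∏ t ∈ Ico (n + 1 + l) (n + k + 1), g t else 0)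
    (k m l : ℕ) (hl : k ≤ l) : KL k m l = 0 := by
  rw [hKL, if_neg (fun h3 => by omega)]

/-- **ONE-LAG STRUCTURE**: `KL k (m+1) l = (1 − θ_k(m;1))·KL k m (l+1)` for `l + 1 < k` ((E75a) `persistence_eq` at lag one). [folklore] -/
theorem flow_onelag_structure (hh : SeqBox γ h)
    (hKL : ∀ k n l, KL k n l = if 0 < k ∧ k < K ∧ l < k then L k * h (n + k) ^ 3 / 2 * ∏ t ∈ Ico (n + 1 + l) (n + k + 1), g t else 0)
    (hθ : ∀ k n l, θ k n l = 1 - (h (n + k + l) / h (n + k)) ^ 3 * ∏ t ∈ Ico (n + k + 1) (n + k + l + 1), g t)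
    (k m l : ℕ) (hl : l + 1 < k) : KL k (m + 1) l = (1 - θ k m 1) * KL k m (l + 1) :=
  (persistence_eq (y := 0) (fun n => (hh n).1) hKL hθ hl).symm

/-- The one-lag persistence factor lies in `]0, 1]`. [folklore] -/
theorem flow_sigma_mem (hh : SeqBox γ h) (hanti : Antitone h) (hg : ∀ t, 0 < g t ∧ g t ≤ 1)
    (hθ : ∀ k n l, θ k n l = 1 - (h (n + k + l) / h (n + k)) ^ 3 * ∏ t ∈ Ico (n + k + 1) (n + k + l + 1), g t)
    (k m : ℕ) : 0 < 1 - θ k m 1 ∧ 1 - θ k m 1 ≤ 1 := by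
  have hh0 : ∀ n, 0 < h n := fun n => (hh n).1
  refine ⟨?_, by linarith [defect_nonneg hh0 hanti hg hθ k m 1]⟩
  rw [hθ, sub_sub_cancel]
  exact mul_pos (pow_pos (div_pos (hh0 _) (hh0 _)) 3) (prod_damping_pos hg _)

/-! ## §2 The one-lag decay of every age's coefficient along the flow -/

/-- **THE ONE-LAG DECAY OF AN AGE'S OWN COEFFICIENT.**  `B` isotone with floor `b > 0`, dominated by `L ≥ 0` on the ages `< K`; `h` a box solution;
`1 ≤ k < K`.  Then `(h_{m+k+1}∕h_{m+k})³·(1 + L_kh_{m+k}³∕2) ≤ 1`, i.e. `c_{m+1}·(1 + c_m) ≤ c_m` for `c_m = L_kh_{m+k}³∕2`: with `r = h_{m+k}∕h_{m+k+1}`,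
`r² − 1 = h_{m+k}²·B(h(m+k+1+·)) ≥ L_kh_{m+k}²h_{m+2k+1}` (domination, the age's own term), `h_{m+k} ≤ √3·h_{m+2k+1}` (concavity (E58b) `mul_invSq_add_le`:
`a_{m+2k+1} ≤ (1 + (k+1)∕(m+k))·a_{m+k} ≤ 3a_{m+k}`), and `r³ − 1 ≥ (3∕2)(r² − 1)`. [folklore] -/
theorem cube_ratio_one_lag (hmono : ∀ u v : ℕ → ℝ, SeqBox γ u → SeqBox γ v → (∀ j, u j ≤ v j) → B u ≤ B v) (hL : ∀ k, 0 ≤ L k)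
    (hb : 0 < b) (hlo : ∀ u, SeqBox γ u → b ≤ B u) (hdom : ∀ u, SeqBox γ u → ∑ k ∈ range K, L k * u k ≤ B u)
    (hh : SeqBox γ h) (hf : MemFlow B gIR h) {k : ℕ} (hk1 : 1 ≤ k) (hkK : k < K) (m : ℕ) :
    (h (m + k + 1) / h (m + k)) ^ 3 * (1 + L k * h (m + k) ^ 3 / 2) ≤ 1 := by
  have hh0 : ∀ n, 0 < h n := fun n => (hh n).1
  have hanti := (strictAnti_of_memFlow hb hlo hh hf).antitone
  have hgIR : 0 < gIR := by rw [← hf.1]; exact hh0 0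
  have hA := hh0 (m + k); have hBv := hh0 (m + k + 1); have hC := hh0 (m + k + (k + 1)); have hLk := hL k
  -- the level step at depth m+k reads the age's own coupling
  have e1 := hf.2 (m + k)
  have hinc : L k * h (m + k + (k + 1)) ≤ B (fun j => h (m + k + 1 + j)) := by
    refine le_trans ?_ (hdom _ (seqBox_shift hh (m + k + 1)))
    rw [show m + k + (k + 1) = m + k + 1 + k by ring]
    exact single_le_sum (f := fun k' => L k' * h (m + k + 1 + k')) (fun k' _ => mul_nonneg (hL k') (hh0 _).le) (mem_range.mpr hkK)
  -- concavity across the window below: a_{m+2k+1} ≤ 3 a_{m+k}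
  have hconc := mul_invSq_add_le hmono hb hlo hgIR hh hf (m + k) (k + 1)
  have hmk : (1:ℝ) ≤ ((m + k : ℕ) : ℝ) := by exact_mod_cast (by omega : 1 ≤ m + k)
  have hk2 : (((k + 1 : ℕ)) : ℝ) ≤ 2 * ((m + k : ℕ) : ℝ) := by
    have hk1' : (1:ℝ) ≤ k := by exact_mod_cast hk1
    have hm0 : (0:ℝ) ≤ m := Nat.cast_nonneg m
    push_cast; linarith
  have hCA : h (m + k) ^ 2 ≤ (3:ℝ) * h (m + k + (k + 1)) ^ 2 := by
    -- (m+k)/C² ≤ 3(m+k)/A²  ⟹  A² ≤ 3 C²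
    have h1 : ((m + k : ℕ) : ℝ) * (1 / h (m + k + (k + 1)) ^ 2) ≤ 3 * ((m + k : ℕ) : ℝ) * (1 / h (m + k) ^ 2) := by
      have := hconc; nlinarith [one_div_nonneg.mpr (sq_nonneg (h (m + k)))]
    have h2 : 1 / h (m + k + (k + 1)) ^ 2 ≤ 3 * (1 / h (m + k) ^ 2) := by
      have := mul_le_mul_of_nonneg_left h1 (show (0:ℝ) ≤ 1 / ((m + k : ℕ) : ℝ) by positivity)
      rwa [← mul_assoc, one_div_mul_cancel (by positivity), one_mul, show 1 / ((m + k : ℕ) : ℝ) * (3 * ((m + k : ℕ) : ℝ) * (1 / h (m + k) ^ 2)) =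
        3 * (1 / h (m + k) ^ 2) by field_simp] at this
    rw [div_le_iff₀ (pow_pos hC 2)] at h2
    rw [show 3 * (1 / h (m + k) ^ 2) * h (m + k + (k + 1)) ^ 2 = 3 * h (m + k + (k + 1)) ^ 2 / h (m + k) ^ 2 by ring,
      le_div_iff₀ (pow_pos hA 2), one_mul] at h2
    exact h2
  have hCA' : h (m + k) ≤ 3 * h (m + k + (k + 1)) := by
    have : h (m + k) ^ 2 ≤ (3 * h (m + k + (k + 1))) ^ 2 := by nlinarith
    exact (pow_le_pow_iff_left₀ hA.le (by positivity) two_ne_zero).mp this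
  -- r = A/Bv ≥ 1, r² ≥ 1 + L_k A² C, r³ ≥ 1 + L_k A³/2
  set r := h (m + k) / h (m + k + 1) with hr
  have hr1 : 1 ≤ r := (one_le_div hBv).mpr (hanti (by omega))
  have hBinc : B (fun j => h (m + k + 1 + j)) = 1 / h (m + k + 1) ^ 2 - 1 / h (m + k) ^ 2 := by linarith [e1]
  have hr2 : r ^ 2 = 1 + h (m + k) ^ 2 * B (fun j => h (m + k + 1 + j)) := by
    rw [hr, div_pow, hBinc]
    field_simp
    ring
  have hr2' : 1 + L k * h (m + k) ^ 2 * h (m + k + (k + 1)) ≤ r ^ 2 := by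
    rw [hr2]; nlinarith [mul_le_mul_of_nonneg_left hinc (sq_nonneg (h (m + k)))]
  have hkey : 1 + L k * h (m + k) ^ 3 / 2 ≤ r ^ 3 := by
    nlinarith [mul_nonneg (sq_nonneg (r - 1)) (by linarith : (0:ℝ) ≤ r + 1 / 2),
      mul_nonneg (mul_nonneg hLk (sq_nonneg (h (m + k)))) (by linarith : (0:ℝ) ≤ 3 * h (m + k + (k + 1)) - h (m + k))]
  have hr0 : 0 < r := by positivity
  have hinv : h (m + k + 1) / h (m + k) = 1 / r := by rw [hr, one_div_div]
  rw [hinv, div_pow, one_pow, div_mul_eq_mul_div, one_mul, div_le_one (pow_pos hr0 3)]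
  exact hkey

/-- **THE ONE-LAG DECAY IN KERNEL LETTERS**: `(1 − θ_k(m;1))·(1 + KL k m 0) ≤ 1` for every age `k` along every box solution and every damping in `]0,1]`
(for `k = 0` or `k ≥ K` the kernel vanishes and the factor is `≤ 1`). [folklore] -/
theorem flow_onelag_decay (hmono : ∀ u v : ℕ → ℝ, SeqBox γ u → SeqBox γ v → (∀ j, u j ≤ v j) → B u ≤ B v) (hL : ∀ k, 0 ≤ L k)
    (hb : 0 < b) (hlo : ∀ u, SeqBox γ u → b ≤ B u) (hdom : ∀ u, SeqBox γ u → ∑ k ∈ range K, L k * u k ≤ B u)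
    (hh : SeqBox γ h) (hf : MemFlow B gIR h) (hg : ∀ t, 0 < g t ∧ g t ≤ 1)
    (hKL : ∀ k n l, KL k n l = if 0 < k ∧ k < K ∧ l < k then L k * h (n + k) ^ 3 / 2 * ∏ t ∈ Ico (n + 1 + l) (n + k + 1), g t else 0)
    (hθ : ∀ k n l, θ k n l = 1 - (h (n + k + l) / h (n + k)) ^ 3 * ∏ t ∈ Ico (n + k + 1) (n + k + l + 1), g t)
    (k m : ℕ) : (1 - θ k m 1) * (1 + KL k m 0) ≤ 1 := by
  have hh0 : ∀ n, 0 < h n := fun n => (hh n).1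
  have hanti := (strictAnti_of_memFlow hb hlo hh hf).antitone
  obtain ⟨hσ0, hσ1⟩ := flow_sigma_mem hh hanti hg hθ k m
  obtain ⟨hK0, hKle⟩ := kernel_entry_le hL hh hg hKL k m 0
  by_cases hk : 0 < k ∧ k < K
  · rw [if_pos hk.1] at hKle
    have hρ : 1 - θ k m 1 ≤ (h (m + k + 1) / h (m + k)) ^ 3 := by
      rw [hθ, sub_sub_cancel, show m + k + 1 + 1 = m + k + 2 by ring]
      exact mul_le_of_le_one_right (pow_nonneg (div_nonneg (hh0 _).le (hh0 _).le) 3) (prod_damping_le_one hg _)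
    have hc := cube_ratio_one_lag hmono hL hb hlo hdom hh hf (Nat.one_le_of_lt hk.1) hk.2 m
    calc (1 - θ k m 1) * (1 + KL k m 0) ≤ (h (m + k + 1) / h (m + k)) ^ 3 * (1 + L k * h (m + k) ^ 3 / 2) :=
          mul_le_mul hρ (by linarith) (by linarith) (pow_nonneg (div_nonneg (hh0 _).le (hh0 _).le) 3)
      _ ≤ 1 := hc
  · have : KL k m 0 = 0 := by rw [hKL, if_neg (fun h3 => hk ⟨h3.1, h3.2.1⟩)]
    rw [this, add_zero, mul_one]; exact hσ1

/-! ## §3 The oldest age's truncation reads are supersolution data -/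

/-- **ROW MASSES ARE AT MOST ONE**: `Σ_l KL k m l ≤ k·L_kh_{m+k}³∕2 ≤ 1` along every box solution ((E82b) `row_mass_le` and the window cap
(E75a) `load_le_cap_at_pin`: `L_kh_{m+k}³·S_{k,k} ≤ 1` with `S_{k,k} = Σ_{l<k}√(k∕(k+l+1)) ≥ k∕2`). [folklore] -/
theorem flow_row_mass_le_one (hmono : ∀ u v : ℕ → ℝ, SeqBox γ u → SeqBox γ v → (∀ j, u j ≤ v j) → B u ≤ B v) (hL : ∀ k, 0 ≤ L k)
    (hb : 0 < b) (hlo : ∀ u, SeqBox γ u → b ≤ B u) (hdom : ∀ u, SeqBox γ u → ∑ k ∈ range K, L k * u k ≤ B u)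
    (hh : SeqBox γ h) (hf : MemFlow B gIR h) (hg : ∀ t, 0 < g t ∧ g t ≤ 1)
    (hKL : ∀ k n l, KL k n l = if 0 < k ∧ k < K ∧ l < k then L k * h (n + k) ^ 3 / 2 * ∏ t ∈ Ico (n + 1 + l) (n + k + 1), g t else 0)
    (k m : ℕ) : ∑ l ∈ range K, KL k m l ≤ 1 := by
  have hh0 : ∀ n, 0 < h n := fun n => (hh n).1
  by_cases hkK : k < K
  · refine (row_mass_le hL hh hg hKL hkK m).trans ?_
    have hcap := load_le_cap_at_pin hmono hL hb hlo hdom hh hf m (mem_range.mpr hkK)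
    -- S_{k,k} ≥ k/2
    have hS : (k : ℝ) / 2 ≤ ∑ l ∈ range k, Real.sqrt ((k : ℝ) / ((k : ℝ) + l + 1)) := by
      have hterm : ∀ l ∈ range k, (1:ℝ) / 2 ≤ Real.sqrt ((k : ℝ) / ((k : ℝ) + l + 1)) := by
        intro l hl
        have hl' : (l : ℝ) + 1 ≤ k := by exact_mod_cast (mem_range.mp hl : l < k)
        have hq : (1:ℝ) / 2 ≤ (k : ℝ) / ((k : ℝ) + l + 1) := by
          rw [div_le_div_iff₀ (by norm_num) (by positivity)]; linarith
        calc (1:ℝ) / 2 ≤ (k : ℝ) / ((k : ℝ) + l + 1) := hq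
          _ ≤ Real.sqrt ((k : ℝ) / ((k : ℝ) + l + 1)) := by
              refine Real.le_sqrt_of_sq_le ?_
              have h1 : (k : ℝ) / ((k : ℝ) + l + 1) ≤ 1 := (div_le_one (by positivity)).mpr (by linarith)
              have h0 : 0 ≤ (k : ℝ) / ((k : ℝ) + l + 1) := by positivity
              nlinarith
      have := sum_le_sum hterm
      rwa [sum_const, card_range, nsmul_eq_mul, mul_one_div] at this
    have hc0 : 0 ≤ L k * h (m + k) ^ 3 := mul_nonneg (hL k) (pow_nonneg (hh0 _).le 3)
    have := mul_le_mul_of_nonneg_left hS hc0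
    nlinarith
  · rw [sum_eq_zero fun l _ => by rw [hKL, if_neg (fun h3 => hkK h3.2.1)]]; norm_num

/-- The truncation inputs are supersolutions of the lone kernel: `RL k 1_{[0,j]} ≤ 1_{[0,j]}` (partial row masses `≤ 1`; zero beyond the edge). [folklore] -/
theorem flow_trunc_key (hmono : ∀ u v : ℕ → ℝ, SeqBox γ u → SeqBox γ v → (∀ j, u j ≤ v j) → B u ≤ B v) (hL : ∀ k, 0 ≤ L k)
    (hb : 0 < b) (hlo : ∀ u, SeqBox γ u → b ≤ B u) (hdom : ∀ u, SeqBox γ u → ∑ k ∈ range K, L k * u k ≤ B u)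
    (hh : SeqBox γ h) (hf : MemFlow B gIR h) (hg : ∀ t, 0 < g t ∧ g t ≤ 1)
    (hKL : ∀ k n l, KL k n l = if 0 < k ∧ k < K ∧ l < k then L k * h (n + k) ^ 3 / 2 * ∏ t ∈ Ico (n + 1 + l) (n + k + 1), g t else 0)
    {RL : ℕ → (ℕ → ℝ) → ℕ → ℝ} (hRL : ∀ i v m, RL i v m = ∑ l ∈ range K, KL i m l * v (m + 1 + l)) (k j m : ℕ) :
    RL k (fun m => if m ≤ j then (1:ℝ) else 0) m ≤ (fun m => if m ≤ j then (1:ℝ) else 0) m := by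
  have hh0 : ∀ n, 0 < h n := fun n => (hh n).1
  have hK0 := weight_nonneg hL hh0 hg hKL
  rw [hRL]
  beta_reduce
  split_ifs with hm
  · refine le_trans (sum_le_sum fun l _ => ?_) (flow_row_mass_le_one hmono hL hb hlo hdom hh hf hg hKL k m)
    have := hK0 k m l
    split_ifs <;> nlinarith
  · refine (sum_eq_zero fun l _ => ?_).le
    rw [if_neg (by omega), mul_zero]

/-! ## §4 MONO″ of the oldest age along the flow from the entering-lag criterion -/

/-- **MONO″ OF AN AGE `k` ALONG THE FLOW FROM THE ENTERING-LAG CRITERION.**  `B` isotone with floor `b > 0`, dominated by `L ≥ 0` on the ages `< K`; `h` a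
box solution; `g` any damping in `]0,1]`; (E80e)'s lone kernels `KL`, defects `θ`, reads `RL` and zero-tailed solution operators `SL` on the horizon `K`;
`1 ≤ k ≤ K`.  IF the entering-lag criterion holds at the pins `m` with `m + 1 + k ≤ K` —
`KL k (m+1) (k−1) − σ_m·KL k m 0 ≤ (Σ_{l<k} KL k (m+1) l·(1 − Σ_{l'} KL k (m+2+l) l'))·(1 − σ_m − σ_m·KL k m 0)`, `σ_m = 1 − θ_k(m;1)` — THEN for every
truncation `j ≤ K` the drops `m ↦ RL k (SL k 1_{[0,j]}) m` are non-increasing (the edge regime is free: (E83a)). [folklore] -/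
theorem flow_mono2_top_of_crit (hmono : ∀ u v : ℕ → ℝ, SeqBox γ u → SeqBox γ v → (∀ j, u j ≤ v j) → B u ≤ B v) (hL : ∀ k, 0 ≤ L k)
    (hb : 0 < b) (hlo : ∀ u, SeqBox γ u → b ≤ B u) (hdom : ∀ u, SeqBox γ u → ∑ k ∈ range K, L k * u k ≤ B u)
    (hh : SeqBox γ h) (hf : MemFlow B gIR h) (hg : ∀ t, 0 < g t ∧ g t ≤ 1)
    (hKL : ∀ k n l, KL k n l = if 0 < k ∧ k < K ∧ l < k then L k * h (n + k) ^ 3 / 2 * ∏ t ∈ Ico (n + 1 + l) (n + k + 1), g t else 0)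
    (hθ : ∀ k n l, θ k n l = 1 - (h (n + k + l) / h (n + k)) ^ 3 * ∏ t ∈ Ico (n + k + 1) (n + k + l + 1), g t)
    {RL SL : ℕ → (ℕ → ℝ) → ℕ → ℝ} (hRL : ∀ i v m, RL i v m = ∑ l ∈ range K, KL i m l * v (m + 1 + l))
    (hSL : ∀ i (w : ℕ → ℝ), (∀ m, K < m → w m = 0) → (∀ m, K < m → SL i w m = 0) ∧ ∀ m, SL i w m = w m - RL i (SL i w) m)
    {k : ℕ} (hk1 : 1 ≤ k) (hkK : k ≤ K)
    (hcrit : ∀ m, m + 1 + k ≤ K → KL k (m + 1) (k - 1) - (1 - θ k m 1) * KL k m 0 ≤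
      (∑ l ∈ range k, KL k (m + 1) l * (1 - ∑ l' ∈ range K, KL k (m + 2 + l) l')) * (1 - (1 - θ k m 1) - (1 - θ k m 1) * KL k m 0)) :
    ∀ j, j ≤ K → ∀ m, RL k (SL k (fun m => if m ≤ j then (1:ℝ) else 0)) (m + 1) ≤ RL k (SL k (fun m => if m ≤ j then (1:ℝ) else 0)) m := by
  have hh0 : ∀ n, 0 < h n := fun n => (hh n).1
  have hanti := (strictAnti_of_memFlow hb hlo hh hf).antitone
  exact mono2_top_of_onelag hRL (weight_nonneg hL hh0 hg hKL) hSL (fun m l hl => flow_window_zero hKL k m l hl) hk1 hkK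
    (fun m l hl => flow_onelag_structure hh hKL hθ k m l hl) (fun m => flow_sigma_mem hh hanti hg hθ k m)
    (fun m => flow_onelag_decay hmono hL hb hlo hdom hh hf hg hKL hθ k m)
    (fun j _ m => flow_trunc_key hmono hL hb hlo hdom hh hf hg hKL hRL k j m) hcrit

/-! ## §5 The undamped first-order model: MONO″ of every age outright -/

/-- Without damping every entry inside the window is the bare coefficient: `KL k m l = L_kh_{m+k}³∕2` for `0 < k < K`, `l < k`. [folklore] -/
theorem undamped_entry (hg1 : ∀ t, g t = 1)
    (hKL : ∀ k n l, KL k n l = if 0 < k ∧ k < K ∧ l < k then L k * h (n + k) ^ 3 / 2 * ∏ t ∈ Ico (n + 1 + l) (n + k + 1), g t else 0)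
    {k m l : ℕ} (hk : 0 < k) (hkK : k < K) (hl : l < k) : KL k m l = L k * h (m + k) ^ 3 / 2 := by
  rw [hKL, if_pos ⟨hk, hkK, hl⟩, prod_eq_one fun t _ => hg1 t, mul_one]

/-- **MONO″ OF EVERY AGE IN THE UNDAMPED FIRST-ORDER MODEL — NO HYPOTHESIS LEFT.**  As `flow_mono2_top_of_crit` with `g ≡ 1`: the entering entry
`KL k (m+1) (k−1) = c_{m+1}` EQUALS `σ_m·KL k m 0 = (c_{m+1}∕c_m)·c_m`, so the criterion's left side vanishes while its right side is non-negative (row masses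
`≤ 1`, one-lag decay); hence for every age `1 ≤ k ≤ K` of every profile, along every box solution, the drops of every truncation `j ≤ K` are non-increasing
at every pin. [folklore] -/
theorem flow_mono2_top_undamped (hmono : ∀ u v : ℕ → ℝ, SeqBox γ u → SeqBox γ v → (∀ j, u j ≤ v j) → B u ≤ B v) (hL : ∀ k, 0 ≤ L k)
    (hb : 0 < b) (hlo : ∀ u, SeqBox γ u → b ≤ B u) (hdom : ∀ u, SeqBox γ u → ∑ k ∈ range K, L k * u k ≤ B u)
    (hh : SeqBox γ h) (hf : MemFlow B gIR h) (hg1 : ∀ t, g t = 1)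
    (hKL : ∀ k n l, KL k n l = if 0 < k ∧ k < K ∧ l < k then L k * h (n + k) ^ 3 / 2 * ∏ t ∈ Ico (n + 1 + l) (n + k + 1), g t else 0)
    (hθ : ∀ k n l, θ k n l = 1 - (h (n + k + l) / h (n + k)) ^ 3 * ∏ t ∈ Ico (n + k + 1) (n + k + l + 1), g t)
    {RL SL : ℕ → (ℕ → ℝ) → ℕ → ℝ} (hRL : ∀ i v m, RL i v m = ∑ l ∈ range K, KL i m l * v (m + 1 + l))
    (hSL : ∀ i (w : ℕ → ℝ), (∀ m, K < m → w m = 0) → (∀ m, K < m → SL i w m = 0) ∧ ∀ m, SL i w m = w m - RL i (SL i w) m)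
    {k : ℕ} (hk1 : 1 ≤ k) (hkK : k ≤ K) :
    ∀ j, j ≤ K → ∀ m, RL k (SL k (fun m => if m ≤ j then (1:ℝ) else 0)) (m + 1) ≤ RL k (SL k (fun m => if m ≤ j then (1:ℝ) else 0)) m := by
  have hg : ∀ t, 0 < g t ∧ g t ≤ 1 := fun t => by rw [hg1 t]; norm_num
  have hh0 : ∀ n, 0 < h n := fun n => (hh n).1
  have hK0 := weight_nonneg hL hh0 hg hKL
  refine flow_mono2_top_of_crit hmono hL hb hlo hdom hh hf hg hKL hθ hRL hSL hk1 hkK fun m hm => ?_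
  have hkK' : k < K := by omega
  -- left side vanishes: c_{m+1} − (h_{m+k+1}/h_{m+k})³ · c_m = 0
  have hσ : 1 - θ k m 1 = (h (m + k + 1) / h (m + k)) ^ 3 := by
    rw [hθ, sub_sub_cancel, prod_eq_one fun t _ => hg1 t, mul_one]
  have hA : h (m + k) ≠ 0 := (hh0 _).ne'
  have hprod : (h (m + k + 1) / h (m + k)) ^ 3 * (L k * h (m + k) ^ 3 / 2) = L k * h (m + k + 1) ^ 3 / 2 := by
    field_simp
  have hlhs : KL k (m + 1) (k - 1) - (1 - θ k m 1) * KL k m 0 = 0 := by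
    rw [undamped_entry hg1 hKL (by omega) hkK' (by omega), undamped_entry hg1 hKL (by omega) hkK' (by omega), hσ, hprod,
      show m + 1 + k = m + k + 1 by ring, sub_self]
  rw [hlhs]
  refine mul_nonneg (sum_nonneg fun l _ => mul_nonneg (hK0 _ _ _) ?_) ?_
  · linarith [flow_row_mass_le_one hmono hL hb hlo hdom hh hf hg hKL k (m + 2 + l)]
  · have := flow_onelag_decay hmono hL hb hlo hdom hh hf hg hKL hθ k m
    linarith

end Summit.QuantumFields.BalabanUV.Beta.EriceRemainderEnclosureHistoryAutonomyComparisonAgeCompositionEnteringLagFlow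

end
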